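import Summits.ABC.ABC.Theorems.CongruentialReceptacleTameLocalReceptacleQLLemmas

/-!
# Crux `TameLocalReceptacle` (stmt-ABC-14354): Legendre-symbol matching of the shared atoms

For the all-square certificate `T⁻ = (x, y, 32w)`, `T₁⁺ = (x, Y, 50w)`, `T₂⁺ = (X, y, 16W)`
(`Theorems/CongruentialReceptacleTameLocalReceptacleQLCertificate.lean`), at every odd prime of a
shared member the residues read by the table have EQUAL Legendre symbols on the two sides:

* `ql_match_x` — `p ∣ x`: partners `Y ≡ 50w`, `y ≡ 32w (mod p)`, and `32 = 2·4²`, `50 = 2·5²`;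
* `ql_match_y` — `p ∣ y`: `J(X) = J(r⁴) = 1 = J(16W) = J((2q)⁴)`, and `J(x) = J(32w) = J(2w) = 1`
  because `18w ≡ s⁴ (mod p)`;
* `ql_match_w` — `p ∣ w` (the shared cofactor of the C-members): partners `Y ≡ y (mod p)` and unit
  residues `50w/p^v = 5²·(2w′)`, `32w/p^v = 4²·(2w′)`.

Used by `Theorems/TameLocalReceptacle/Negative/TameLocalReceptacleQuadraticLocal.lean`
(lead `prover-line-stmt-ABC-14354-0`).
-/

-- `Summit.<Summit>.<Problem>` is the mandated summit-side namespace (CONVENTIONS §2); for the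
-- single-conjunct summit `ABC` the two coincide, so the duplicate `ABC.ABC` is deliberate.
set_option linter.dupNamespace false

namespace Summit.ABC.ABC.Theorems.TameLocalReceptacle

open NumberTheorySymbols Literature.NumberTheory.QuadraticFields

/-- `4` is prime to every odd prime. [folklore] -/
theorem coprime_four_of_odd_prime {p : ℕ} (pp : p.Prime) (hp2 : p ≠ 2) : Nat.Coprime 4 p := by
  have e : (4 : ℕ) = 2 ^ 2 := by norm_num
  rw [e]; exact Nat.Coprime.pow_left 2 ((Nat.coprime_primes Nat.prime_two pp).mpr (Ne.symm hp2))

/-- **A-position match** (`p ∣ x`): the partners `Y` (in `T₁⁺`) and `y` (in `T⁻`) and the C-members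
`50w ≡ Y`, `32w ≡ y (mod p)` have equal Legendre symbols. [folklore] -/
theorem ql_match_x {p x y Y w : ℕ} (pp : p.Prime) (hp2 : p ≠ 2) (hp5 : p ≠ 5) (hpx : p ∣ x)
    (hx : x + y = 32 * w) (hxY : x + Y = 50 * w) :
    J((Y : ℤ) | p) = J((y : ℤ) | p) ∧ J(((50 * w : ℕ) : ℤ) | p) = J(((32 * w : ℕ) : ℤ) | p) := by
  have cop4 := coprime_four_of_odd_prime pp hp2
  have cop5 : Nat.Coprime 5 p := (Nat.coprime_primes (by norm_num) pp).mpr (Ne.symm hp5)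
  have jy : J((y : ℤ) | p) = J(((2 * w : ℕ) : ℤ) | p) := by
    rw [jacobiSym_of_dvd_of_add_eq hpx hx, show 32 * w = 4 ^ 2 * (2 * w) by ring,
      jacobiSym_mul_nat, jacobiSym_sq_nat cop4, one_mul]
  have jY : J((Y : ℤ) | p) = J(((2 * w : ℕ) : ℤ) | p) := by
    rw [jacobiSym_of_dvd_of_add_eq hpx hxY, show 50 * w = 5 ^ 2 * (2 * w) by ring,
      jacobiSym_mul_nat, jacobiSym_sq_nat cop5, one_mul]
  refine ⟨by rw [jY, jy], ?_⟩
  rw [← jacobiSym_of_dvd_of_add_eq hpx hx, ← jacobiSym_of_dvd_of_add_eq hpx hxY, jy, jY]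

/-- **B-position match** (`p ∣ y`): the partners `X = r⁴` (in `T₂⁺`) and `x ≡ 32w` (in `T⁻`) and the
C-members `16W = (2q)⁴`, `32w ≡ x (mod p)` all have Legendre symbol `1` (for `x`: `18w ≡ Y = s⁴`).
[folklore] -/
theorem ql_match_y {p x y X W Y w r q s : ℕ} (pp : p.Prime) (hp2 : p ≠ 2) (hp3 : p ≠ 3)
    (hpy : p ∣ y) (hX : X = r ^ 4) (hW : W = q ^ 4) (hY : Y = s ^ 4) (hx : x + y = 32 * w)
    (hw : 18 * w + y = Y) (hpr : ¬ p ∣ r) (hpq : ¬ p ∣ q) (hps : ¬ p ∣ s) :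
    J((X : ℤ) | p) = 1 ∧ J((x : ℤ) | p) = 1 ∧ J(((16 * W : ℕ) : ℤ) | p) = 1 ∧
      J(((32 * w : ℕ) : ℤ) | p) = 1 := by
  have cop4 := coprime_four_of_odd_prime pp hp2
  have cop3 : Nat.Coprime 3 p := (Nat.coprime_primes Nat.prime_three pp).mpr (Ne.symm hp3)
  have copr : Nat.Coprime r p := Nat.coprime_comm.mp ((Nat.Prime.coprime_iff_not_dvd pp).mpr hpr)
  have copq : Nat.Coprime q p := Nat.coprime_comm.mp ((Nat.Prime.coprime_iff_not_dvd pp).mpr hpq)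
  have cops : Nat.Coprime s p := Nat.coprime_comm.mp ((Nat.Prime.coprime_iff_not_dvd pp).mpr hps)
  have cop2 : Nat.Coprime 2 p := (Nat.coprime_primes Nat.prime_two pp).mpr (Ne.symm hp2)
  have jX : J((X : ℤ) | p) = 1 := by rw [hX]; exact jacobiSym_pow_four copr
  have j16W : J(((16 * W : ℕ) : ℤ) | p) = 1 := by
    rw [hW, show 16 * q ^ 4 = (2 * q) ^ 4 by ring]
    exact jacobiSym_pow_four (Nat.Coprime.mul_left cop2 copq)
  have j2w : J(((2 * w : ℕ) : ℤ) | p) = 1 := by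
    have h1 : J(((18 * w : ℕ) : ℤ) | p) = J((Y : ℤ) | p) := jacobiSym_of_dvd_of_add_eq' hpy hw
    have h2 : J((Y : ℤ) | p) = 1 := by rw [hY]; exact jacobiSym_pow_four cops
    rw [show 18 * w = 3 ^ 2 * (2 * w) by ring, jacobiSym_mul_nat, jacobiSym_sq_nat cop3,
      one_mul] at h1
    rw [h1, h2]
  have jx : J((x : ℤ) | p) = 1 := by
    rw [jacobiSym_of_dvd_of_add_eq' hpy hx, show 32 * w = 4 ^ 2 * (2 * w) by ring,
      jacobiSym_mul_nat, jacobiSym_sq_nat cop4, one_mul, j2w]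
  have j32 : J(((32 * w : ℕ) : ℤ) | p) = 1 := by rw [← jacobiSym_of_dvd_of_add_eq' hpy hx, jx]
  exact ⟨jX, jx, j16W, j32⟩

/-- **C-position match** (`p ∣ w`, the shared cofactor of the C-members `50w` of `T₁⁺` and `32w` of
`T⁻`): the partners agree `Y ≡ y (mod p)` (`18w + y = Y`), and the unit residues `50w/p^v`, `32w/p^v`
(`v = v_p(w)`) are `5²·(2w′)` and `4²·(2w′)`, so their Legendre symbols agree (`p ≠ 2, 5`).
[folklore] -/
theorem ql_match_w {p w y Y : ℕ} (pp : p.Prime) (hp2 : p ≠ 2) (hp5 : p ≠ 5) (hpw : p ∣ w)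
    (hw : 18 * w + y = Y) :
    J((Y : ℤ) | p) = J((y : ℤ) | p) ∧
      J(((50 * w / p ^ w.factorization p : ℕ) : ℤ) | p)
        = J(((32 * w / p ^ w.factorization p : ℕ) : ℤ) | p) := by
  have cop4 := coprime_four_of_odd_prime pp hp2
  have cop5 : Nat.Coprime 5 p := (Nat.coprime_primes (by norm_num) pp).mpr (Ne.symm hp5)
  refine ⟨(jacobiSym_of_dvd_of_add_eq (Dvd.dvd.mul_left hpw 18) hw).symm, ?_⟩
  set v := w.factorization p with hv
  obtain ⟨w', hw'⟩ : p ^ v ∣ w := Nat.ordProj_dvd w p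
  have hpv0 : 0 < p ^ v := pow_pos pp.pos v
  have d50 : 50 * w / p ^ v = 5 ^ 2 * (2 * w') := by
    rw [hw', show 50 * (p ^ v * w') = p ^ v * (5 ^ 2 * (2 * w')) by ring,
      Nat.mul_div_cancel_left _ hpv0]
  have d32 : 32 * w / p ^ v = 4 ^ 2 * (2 * w') := by
    rw [hw', show 32 * (p ^ v * w') = p ^ v * (4 ^ 2 * (2 * w')) by ring,
      Nat.mul_div_cancel_left _ hpv0]
  rw [d50, d32, jacobiSym_mul_nat (5 ^ 2) (2 * w') p, jacobiSym_mul_nat (4 ^ 2) (2 * w') p,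
    jacobiSym_sq_nat cop5, jacobiSym_sq_nat cop4]

end Summit.ABC.ABC.Theorems.TameLocalReceptacle
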